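import Summits.Ventures.LatticeQCDFlow.Scoring.CloverChargeLawSymmetric
import Summits.Ventures.LatticeQCDFlow.Exactness.TransformedKernel
import HarnessLib

/-!
# Out of equilibrium too: a reflection-symmetric sampler started from a reflection-invariant law keeps every odd observable centred, with symmetric law, at EVERY step

HONEST FRAMING: exact (Metropolis-corrected) sampling algorithms for lattice gauge theory;
figures of merit are autocorrelation/cost numbers at stated couplings and volumes; no
continuum-physics claim.

Venture `LatticeQCDFlow` (cell pub-lqcd), sub-topic `Scoring`; FANOUT row 16 (`su2-base`).  NEW WORK of
the cell (placement rule); fifth file of the `⟨Q⟩ = 0` packet.  Files 1–4 (`CloverChargeMeanZero`,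
`WilsonFlowReflectionCovariance`, `CloverDensityMeanZero`, `CloverChargeLawSymmetric`) are statements
about the TARGET `μ_{Λ,β}`.  A run check is applied to a CHAIN, usually not in equilibrium (cold
start `U ≡ 1`, hot start `∏ dHaar`, finite thermalisation).  This file shows the check is exact for the
chain itself at every step `n`, for every Markov kernel `κ` that COMMUTES with the site reflection —
`conjKernel κ Θ' = κ` in the vocabulary of row 7's `Exactness/TransformedKernel` (`conjKernel κ F x =
F_* κ(F⁻¹x)`), i.e. `κ(Θ'U, Θ'A) = κ(U, A)` — started from any `Θ'`-invariant law.  Nothing is cited as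
a fact.  Printed counterpart, NAMED ONLY: none needed (symmetry bookkeeping).

## What is proved

* §1 (abstract; `Θ : Ω ≃ᵐ Ω`, any kernel `κ`, any initial law `μ₀`)
  `map_bind_eq_bind_conjKernel` — `(μ₀κ)∘Θ⁻¹ = (μ₀∘Θ⁻¹)(conjKernel κ Θ)` (change of variables);
  `conjKernel_comp_eq_self` — `Θ`-symmetric kernels compose;
  **`map_bind_nHit_eq_self`** — if `conjKernel κ Θ = κ` and `μ₀ ∘ Θ⁻¹ = μ₀` then the `n`-step law
  `μ₀ κⁿ` is `Θ`-invariant for every `n` (`nHit` of `Exactness/InvariantComposition`);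
  `integral_bind_nHit_eq_zero_of_odd`, `bind_nHit_tail_symm_of_odd` — hence every `Θ`-odd real
  observable has mean `0` and symmetric tails under `μ₀ κⁿ`, every `n`.
* §2 (torus `(ℤ/L)^d`, any group) `negReflect_one` (the cold start `U ≡ 1` is `Θ'`-fixed),
  `dirac_one_map_negReflect`, `piHaar_map_negReflect` (cold and hot starts are `Θ'`-invariant laws).
* §3 (`SU(n)` on `(ℤ/L)^4`, fundamental representation, every `L ≥ 1`, flow time `t`, step `n`)
  **`integral_flowedCloverCharge_nSteps_eq_zero`**: for every kernel `κ` with `conjKernel κ Θ' = κ`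
  and every `Θ'`-invariant start `μ₀`, `∫ Q_t d(μ₀ κⁿ) = 0`; `nSteps_flowedCloverCharge_tail_symm`:
  `(μ₀κⁿ){c ≤ Q_t} = (μ₀κⁿ){Q_t ≤ −c}`; the cold-start and hot-start corollaries
  `integral_flowedCloverCharge_coldStart_eq_zero`, `integral_flowedCloverCharge_hotStart_eq_zero`.

NOT CLAIMED: WHICH samplers satisfy `conjKernel κ Θ' = κ`.  Value-free reading: a heat-bath /
over-relaxation sweep visiting the links in a reflection-symmetric pattern (e.g. checkerboard by
parity classes, or a uniformly random link) and HMC with a reflection-covariant force are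
`Θ'`-symmetric; a fixed lexicographic sweep is NOT literally (its reflection is the reversed sweep),
so for it only the equilibrium statements of files 1–4 apply.  No statement about `β`-dependence,
thermalisation or autocorrelation; any number.
-/

noncomputable section

open Matrix MeasureTheory ProbabilityTheory
open Literature.MathematicalPhysics.QuantumFieldTheory
open Literature.MathematicalPhysics.QuantumLattice (fundamentalRep continuous_fundamentalRep
  fundamentalRep_mem_unitaryGroup cloverPseudoscalar)
open Summit.Ventures.LatticeQCDFlow.Exactness (conjKernel conjKernel_apply' conjKernel_comp conjKernel_nHit
  nHit)

namespace Summit.Ventures.LatticeQCDFlow.Scoring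

/-! ## §1 Symmetric kernels propagate invariant laws; odd observables stay centred -/

section Abstract

variable {Ω : Type*} [MeasurableSpace Ω]

/-- **Change of variables for one step**: `(μ₀κ) ∘ Θ⁻¹ = (μ₀ ∘ Θ⁻¹)(conjKernel κ Θ)` — the image under
`Θ` of the law after one move of `κ` is the law after one move of the REPORTED kernel from the image
start. -/
theorem map_bind_eq_bind_conjKernel (μ₀ : Measure Ω) (κ : Kernel Ω Ω) (Θ : Ω ≃ᵐ Ω) :
    (μ₀.bind κ).map Θ = (μ₀.map Θ).bind (conjKernel κ Θ) := by
  ext s hs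
  rw [Measure.map_apply Θ.measurable hs, Measure.bind_apply (Θ.measurable hs) (Kernel.aemeasurable _),
    Measure.bind_apply hs (Kernel.aemeasurable _), lintegral_map_equiv]
  simp only [conjKernel_apply' κ Θ _ hs, MeasurableEquiv.symm_apply_apply]

/-- **A `Θ`-symmetric kernel maps `Θ`-invariant laws to `Θ`-invariant laws, at every step**:
if `conjKernel κ Θ = κ` and `μ₀ ∘ Θ⁻¹ = μ₀` then `(μ₀ κⁿ) ∘ Θ⁻¹ = μ₀ κⁿ` for every `n`. -/
theorem map_bind_nHit_eq_self {κ : Kernel Ω Ω} {Θ : Ω ≃ᵐ Ω} (hκ : conjKernel κ Θ = κ)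
    {μ₀ : Measure Ω} (hμ₀ : μ₀.map Θ = μ₀) (n : ℕ) :
    (μ₀.bind (nHit κ n)).map Θ = μ₀.bind (nHit κ n) := by
  rw [map_bind_eq_bind_conjKernel, conjKernel_nHit, hκ, hμ₀]

/-- **Symmetric kernels compose**: if `κ` and `η` commute with `Θ`, so does `κ ∘ₖ η` (e.g. a heat-bath
sweep followed by over-relaxation sweeps, each `Θ`-symmetric). -/
theorem conjKernel_comp_eq_self {κ η : Kernel Ω Ω} {Θ : Ω ≃ᵐ Ω} (hκ : conjKernel κ Θ = κ)
    (hη : conjKernel η Θ = η) : conjKernel (κ ∘ₖ η) Θ = κ ∘ₖ η := by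
  rw [conjKernel_comp, hκ, hη]

/-- The `n`-step law of a `Θ`-symmetric chain from a `Θ`-invariant start is preserved by `Θ`. -/
theorem measurePreserving_bind_nHit {κ : Kernel Ω Ω} {Θ : Ω ≃ᵐ Ω} (hκ : conjKernel κ Θ = κ)
    {μ₀ : Measure Ω} (hμ₀ : μ₀.map Θ = μ₀) (n : ℕ) :
    MeasurePreserving Θ (μ₀.bind (nHit κ n)) (μ₀.bind (nHit κ n)) :=
  ⟨Θ.measurable, map_bind_nHit_eq_self hκ hμ₀ n⟩

/-- **Odd observables are centred at every step**: `∫ F d(μ₀κⁿ) = 0` for every `n` when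
`F ∘ Θ = −F`, `κ` is `Θ`-symmetric and `μ₀` is `Θ`-invariant (no integrability needed). -/
theorem integral_bind_nHit_eq_zero_of_odd {E : Type*} [NormedAddCommGroup E] [NormedSpace ℝ E]
    {κ : Kernel Ω Ω} {Θ : Ω ≃ᵐ Ω} (hκ : conjKernel κ Θ = κ) {μ₀ : Measure Ω} (hμ₀ : μ₀.map Θ = μ₀)
    {F : Ω → E} (hF : ∀ x, F (Θ x) = -F x) (n : ℕ) :
    ∫ x, F x ∂(μ₀.bind (nHit κ n)) = 0 :=
  integral_eq_zero_of_measurePreserving_odd Θ (measurePreserving_bind_nHit hκ hμ₀ n) hF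

/-- **Tails are symmetric at every step**: `(μ₀κⁿ){c ≤ F} = (μ₀κⁿ){F ≤ −c}`. -/
theorem bind_nHit_tail_symm_of_odd {κ : Kernel Ω Ω} {Θ : Ω ≃ᵐ Ω} (hκ : conjKernel κ Θ = κ)
    {μ₀ : Measure Ω} (hμ₀ : μ₀.map Θ = μ₀) {F : Ω → ℝ} (hF : ∀ x, F (Θ x) = -F x) (n : ℕ) (c : ℝ) :
    (μ₀.bind (nHit κ n)) {x | c ≤ F x} = (μ₀.bind (nHit κ n)) {x | F x ≤ -c} :=
  measure_le_eq_measure_le_neg_of_odd Θ (measurePreserving_bind_nHit hκ hμ₀ n) hF c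

end Abstract

/-! ## §2 The cold and hot starts are reflection-invariant -/

section Starts

variable {d L : ℕ} [NeZero d] {G : Type*} [Group G]

/-- **The cold start is reflection-fixed**: `Θ'(U ≡ 1) = (U ≡ 1)`. -/
theorem negReflect_one : (1 : GaugeConfig d L G).negReflect = 1 := by
  funext e
  rw [WilsonSiteRP.negReflect_apply]
  split_ifs <;> simp

variable [MeasurableSpace G]

/-- The cold-start law `δ_{U ≡ 1}` is `Θ'`-invariant. -/
theorem dirac_one_map_negReflect [TopologicalSpace G] [IsTopologicalGroup G] [BorelSpace G] :
    (Measure.dirac (1 : GaugeConfig d L G)).map GaugeConfig.negReflect = Measure.dirac 1 := by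
  rw [Measure.map_dirac' WilsonSiteRP.measurable_negReflect, negReflect_one]

/-- The hot-start law `∏ₑ dHaar(U_e)` is `Θ'`-invariant (`WilsonSiteRP.measurePreserving_negReflect`). -/
theorem piHaar_map_negReflect [NeZero L] [TopologicalSpace G] [IsTopologicalGroup G] [CompactSpace G]
    [BorelSpace G] :
    (Measure.pi fun _ : Edge d L => haarProbability G).map
        (GaugeConfig.negReflect : GaugeConfig d L G → GaugeConfig d L G) =
      Measure.pi fun _ : Edge d L => haarProbability G :=
  (WilsonSiteRP.measurePreserving_negReflect (d := d) (L := L) (G := G)).map_eq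

end Starts

/-! ## §3 The flowed clover charge along a reflection-symmetric chain -/

section Chain

variable {L n : ℕ} [NeZero L]

/-- **`E[Q_t(U_n)] = 0` at every step of a reflection-symmetric chain from a reflection-invariant
start.**  `κ` any Markov kernel on `SU(n)` configurations of `(ℤ/L)^4` with
`conjKernel κ Θ' = κ` (`Θ' = WilsonSiteRP.negReflectEquiv`), `μ₀` any start with `μ₀ ∘ Θ'⁻¹ = μ₀`;
`Q_t = Σ_x P_x ∘ V_t` the flowed total clover charge; every `n`, `t`, `L ≥ 1`. -/
theorem integral_flowedCloverCharge_nSteps_eq_zero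
    {κ : Kernel (GaugeConfig 4 L (Matrix.specialUnitaryGroup (Fin n) ℂ))
      (GaugeConfig 4 L (Matrix.specialUnitaryGroup (Fin n) ℂ))}
    (hκ : conjKernel κ (WilsonSiteRP.negReflectEquiv (d := 4) (L := L)) = κ)
    {μ₀ : Measure (GaugeConfig 4 L (Matrix.specialUnitaryGroup (Fin n) ℂ))}
    (hμ₀ : μ₀.map GaugeConfig.negReflect = μ₀) (N : ℕ) (t : ℝ) :
    ∫ U, ∑ x : Site 4 L, cloverPseudoscalar (fundamentalRep (Fin n)) x (wilsonFlow t U)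
      ∂(μ₀.bind (nHit κ N)) = 0 :=
  integral_bind_nHit_eq_zero_of_odd hκ hμ₀ (fun U => sum_cloverPseudoscalar_wilsonFlow_negReflect t U) N

/-- **Symmetric tails at every step**: `(μ₀κᴺ){c ≤ Q_t} = (μ₀κᴺ){Q_t ≤ −c}` under the same hypotheses. -/
theorem nSteps_flowedCloverCharge_tail_symm
    {κ : Kernel (GaugeConfig 4 L (Matrix.specialUnitaryGroup (Fin n) ℂ))
      (GaugeConfig 4 L (Matrix.specialUnitaryGroup (Fin n) ℂ))}
    (hκ : conjKernel κ (WilsonSiteRP.negReflectEquiv (d := 4) (L := L)) = κ)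
    {μ₀ : Measure (GaugeConfig 4 L (Matrix.specialUnitaryGroup (Fin n) ℂ))}
    (hμ₀ : μ₀.map GaugeConfig.negReflect = μ₀) (N : ℕ) (t c : ℝ) :
    (μ₀.bind (nHit κ N))
        {U | c ≤ ∑ x : Site 4 L, cloverPseudoscalar (fundamentalRep (Fin n)) x (wilsonFlow t U)} =
      (μ₀.bind (nHit κ N))
        {U | ∑ x : Site 4 L, cloverPseudoscalar (fundamentalRep (Fin n)) x (wilsonFlow t U) ≤ -c} :=
  bind_nHit_tail_symm_of_odd hκ hμ₀ (fun U => sum_cloverPseudoscalar_wilsonFlow_negReflect t U) N c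

/-- **Cold start**: from `U ≡ 1`, `E[Q_t(U_N)] = 0` at every step `N` of any `Θ'`-symmetric kernel. -/
theorem integral_flowedCloverCharge_coldStart_eq_zero
    {κ : Kernel (GaugeConfig 4 L (Matrix.specialUnitaryGroup (Fin n) ℂ))
      (GaugeConfig 4 L (Matrix.specialUnitaryGroup (Fin n) ℂ))}
    (hκ : conjKernel κ (WilsonSiteRP.negReflectEquiv (d := 4) (L := L)) = κ) (N : ℕ) (t : ℝ) :
    ∫ U, ∑ x : Site 4 L, cloverPseudoscalar (fundamentalRep (Fin n)) x (wilsonFlow t U)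
      ∂((Measure.dirac (1 : GaugeConfig 4 L (Matrix.specialUnitaryGroup (Fin n) ℂ))).bind (nHit κ N)) =
        0 :=
  integral_flowedCloverCharge_nSteps_eq_zero hκ dirac_one_map_negReflect N t

/-- **Hot start**: from `∏ₑ dHaar`, `E[Q_t(U_N)] = 0` at every step `N` of any `Θ'`-symmetric kernel. -/
theorem integral_flowedCloverCharge_hotStart_eq_zero
    {κ : Kernel (GaugeConfig 4 L (Matrix.specialUnitaryGroup (Fin n) ℂ))
      (GaugeConfig 4 L (Matrix.specialUnitaryGroup (Fin n) ℂ))}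
    (hκ : conjKernel κ (WilsonSiteRP.negReflectEquiv (d := 4) (L := L)) = κ) (N : ℕ) (t : ℝ) :
    ∫ U, ∑ x : Site 4 L, cloverPseudoscalar (fundamentalRep (Fin n)) x (wilsonFlow t U)
      ∂((Measure.pi fun _ : Edge 4 L => haarProbability (Matrix.specialUnitaryGroup (Fin n) ℂ)).bind
        (nHit κ N)) = 0 :=
  integral_flowedCloverCharge_nSteps_eq_zero hκ piHaar_map_negReflect N t

end Chain

end Summit.Ventures.LatticeQCDFlow.Scoring

end
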